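import Summits.BirchSwinnertonDyer.Rank1Residual.GaloisImage.ExoticNoHigherLevelTau
import HarnessLib

/-!
# An (H.2)-`τ` at ANY level `p^a` moves `E[p]`: the binder `hτp` of the B1 chain is free
# (cell `b2b-bsdres`, team n1011, row T-a5x-II addendum (II.6); seat p13)

HONEST FRAMING (cell `b2b-bsdres`, run/shared/lean/b2b/bsd-rank1-residual/, verbatim in every
file): the goal of the cell is to DELETE the COMBINATION-SHAPED residual classes of the
Birch–Swinnerton-Dyer formula for ALL analytic-rank `≤ 1` elliptic curves over `ℚ` — "full BSD
formula for every rank `≤ 1` curve in class `C`" assembled STRICTLY from published theorems — so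
that the rank-`≤ 1` remainder becomes exactly the CONSTRUCTION-SHAPED classes, which are TYPED
(missing-input `Prop`s), NOT attempted. This is not "finishing BSD". Team n1011 (N10/N11, the
additive block `X4 ∧ p = 3`): research route; no claim beyond the stated classes; the label X4 and
the mark of RESIDUAL-MAP §I N11 are UNCHANGED by this file; nothing is booked. Theorems only, TOOL
statements: no definition, no named fact.

## What and why

The B1 chain of route R1-23 (n1011-p09 `TransvectionGaloisInputs`, n1011-p18's B1-asm p276707,
the R1-45 records) carries, next to the (H.2)-datum `hτq : E[p^m]/(τ − 1) ≃+ ℤ/p^m`, a binder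
`hτp : ∃ P ∈ E[p], τ • P ≠ P` ("`τ` moves `E[p]`").  Route planner r1 (GEN 16, 28.1 (2)) observed that
`hτp` is FREE at every level: (H.2) at level `p^m` forces `τ` to move `E[p]`.  With the level descent
`nonempty_cokerSubOne_equiv_zmod_pow_of_le` (p275708) this is immediate: descend to level `p`, where
`E[p]/(τ − 1)E[p] ≃ ℤ/p` is incompatible with `τ = 1` on `E[p]` (the cokernel would be all of `E[p]`,
of order `p²`).

* `exists_smul_ne_of_cokerSubOne_equiv_zmod` — level `p`: `E[p]/(τ − 1) ≃+ ℤ/p ⟹ ∃ P ∈ E[p], τ•P ≠ P`.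
* **`exists_smul_ne_of_cokerSubOne_equiv_zmod_pow`** — any level `p^a`, `a ≥ 1`:
  `E[p^a]/(τ − 1) ≃+ ℤ/p^a ⟹ ∃ P ∈ E[p], τ • P ≠ P` — the binder `hτp` of
  `TransvectionGaloisInputs.tau_sq_eq_pow_smul_and_ne` / B1-asm discharged from `hτq` alone.
* `exists_smul_ne_of_cokerSubOne_equiv_zmod_pow_mul` — the `(p:ℤ)^k * p` / `ZMod (p^(k+1))`
  spelling of the N11 instances.

References: R. Sakamoto, JTNB 36 (2024) §2 (H.2) [Sakamoto2024]; J. H. Silverman, *AEC* III.6.4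
[SilvermanAEC2009].
-/

noncomputable section

open scoped Classical
open WeierstrassCurve Literature.NumberTheory.EllipticCurves Literature.NumberTheory.GaloisRepresentations
  Literature.NumberTheory.GaloisRepresentations.DiscreteGaloisModule Literature.NumberTheory.GaloisCohomology

namespace Summit.BirchSwinnertonDyer.Rank1Residual.GaloisImage

variable (W : WeierstrassCurve ℚ) [W.IsElliptic]

/-- **Level `p`: `E[p]/(τ − 1)E[p] ≃+ ℤ/p` forces `τ` to move `E[p]`** — otherwise `τ − 1 = 0` on
`E[p]`, the cokernel is all of `E[p]`, of order `p²` (Silverman III.6.4), not `p`. [folklore] -/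
theorem exists_smul_ne_of_cokerSubOne_equiv_zmod {p : ℕ} (hp : p.Prime) (τ : Field.absoluteGaloisGroup ℚ)
    (hτ : Nonempty (cokerSubOne (W.torsionGaloisModule (p : ℤ)) τ ≃+ ZMod p)) :
    ∃ P : geomTorsion W (p : ℤ), τ • P ≠ P := by
  obtain ⟨e⟩ := hτ
  by_contra hcon
  push Not at hcon
  -- `τ - 1 = 0` on `E[p]`, so its range is `⊥`
  have hbot : (((W.torsionGaloisModule (p : ℤ)) τ).toAddMonoidHom - AddMonoidHom.id _).range = ⊥ := by
    refine (AddSubgroup.eq_bot_iff_forall _).mpr fun r hr => ?_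
    obtain ⟨x, rfl⟩ := AddMonoidHom.mem_range.mp hr
    change τ • x - x = 0
    rw [hcon x, sub_self]
  -- orders: `#E[p] = p²` but `#(E[p]/⊥) = #ℤ/p = p`
  have hE : Nat.card (geomTorsion W (p : ℤ)) = p ^ 2 := by
    have h := natCard_geomTorsion_pow W hp 1
    rwa [pow_one, mul_one] at h
  have hQ : Nat.card (cokerSubOne (W.torsionGaloisModule (p : ℤ)) τ) = p := by
    rw [Nat.card_congr e.toEquiv, Nat.card_zmod]
  have hQ' : Nat.card (cokerSubOne (W.torsionGaloisModule (p : ℤ)) τ) = p ^ 2 := by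
    rw [← hE]
    change Nat.card (geomTorsion W (p : ℤ) ⧸ _) = _
    rw [hbot]
    exact Nat.card_congr (QuotientAddGroup.quotientBot).toEquiv
  rw [hQ] at hQ'
  have : p = 1 := by nlinarith [hp.one_lt, hQ']
  exact hp.one_lt.ne' this

/-- **Any level: an (H.2)-`τ` at level `p^a` (`a ≥ 1`) moves `E[p]`** — the binder `hτp` of the B1
chain (`TransvectionGaloisInputs.tau_sq_eq_pow_smul_and_ne`, B1-asm p276707, the R1-45 records) is a
consequence of `hτq` alone: descend to level `p` (`nonempty_cokerSubOne_equiv_zmod_pow_of_le`, p275708)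
and apply the previous theorem.  Route planner r1's remark (GEN 16, 28.1 (2)) as a kernel fact.
[cite: Sakamoto2024, §2 hypothesis (H.2) (p. 921)] [cite: SilvermanAEC2009, Cor. III.6.4(b)] -/
theorem exists_smul_ne_of_cokerSubOne_equiv_zmod_pow {p : ℕ} (hp : p.Prime) {a : ℕ} (ha : 1 ≤ a)
    (τ : Field.absoluteGaloisGroup ℚ)
    (hτ : Nonempty (cokerSubOne (W.torsionGaloisModule ((p : ℤ) ^ a)) τ ≃+ ZMod (p ^ a))) :
    ∃ P : geomTorsion W (p : ℤ), τ • P ≠ P := by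
  have h1 := nonempty_cokerSubOne_equiv_zmod_pow_of_le W hp (b := 1) ha τ hτ
  rw [pow_one, pow_one] at h1
  exact exists_smul_ne_of_cokerSubOne_equiv_zmod W hp τ h1

/-- The same in the `(p:ℤ)^k * p` / `ZMod (p^(k+1))` spelling of the N11 instances (`E[p^k·p]`).
[cite: Sakamoto2024, §2 hypothesis (H.2) (p. 921)] -/
theorem exists_smul_ne_of_cokerSubOne_equiv_zmod_pow_mul {p : ℕ} (hp : p.Prime) (k : ℕ)
    (τ : Field.absoluteGaloisGroup ℚ)
    (hτ : Nonempty (cokerSubOne (W.torsionGaloisModule ((p : ℤ) ^ k * (p : ℤ))) τ ≃+ ZMod (p ^ (k + 1)))) :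
    ∃ P : geomTorsion W (p : ℤ), τ • P ≠ P := by
  rw [← pow_succ] at hτ
  exact exists_smul_ne_of_cokerSubOne_equiv_zmod_pow W hp (Nat.succ_le_succ (Nat.zero_le k)) τ hτ

end Summit.BirchSwinnertonDyer.Rank1Residual.GaloisImage

end
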